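import Mathlib
import HarnessLib
import Summits.Langlands.Langlands.Theses.SiegelEisensteinFern
import Literature.NumberTheory.Automorphic.OrdinaryPolarizedAutomorphicLimit
import Literature.NumberTheory.Automorphic.IsAutomorphicAE
import Literature.NumberTheory.Automorphic.HarrisLanTaylorThorneCor627

/-!
# Birth skeleton (BC3) for crux stmt-Langlands-2691
`Summit.Langlands.Langlands.Theses.SiegelEisensteinFern.SiegelLimitReciprocity` — line `birth`

Route `route-Langlands-SiegelEisensteinFern` (`closes : SiegelLimitExistence → SiegelLimitReciprocity →
BeyondSiegelFern → Langlands`).  The crux C2 says: fix the binding data BIND of the route (a CM field `K`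
containing an imaginary quadratic field in which `ℓ` splits, `n ≥ 2`, `ι : ℚ̄_ℓ ≃ ℂ`, the polarization
involution `θ = θ_c`, and `ρ : Γ_K → GL_n(ℚ̄_ℓ)` irreducible, NOT polarizable in trace form, a.e.
unramified, cyclotomic-ordinary with strictly decreasing integer exponents at every `v ∣ ℓ`); then for
EVERY character `μ : Γ_K → ℚ̄_ℓ^×`, if the Siegel–Eisenstein trace
`T_{ρ,μ} = tr ρ + tr μ · tr ((ρ ∘ θ)^∨)` is an `ℓ`-adic limit of ordinary, polarized, cuspidal-automorphic
traces of total dimension `2n` and level `S_{ρ,μ} = {v ∤ ℓ : ρ, μ unramified at v}`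
(`Literature.NumberTheory.Automorphic.IsOrdinaryPolarizedAutomorphicLimit`, the one-line form of the
route's inline `∀ M, ∃ k d hd P r, …` clause — `isOrdinaryPolarizedAutomorphicLimit_iff`), then `ρ` is
automorphic (`Literature.NumberTheory.Automorphic.IsAutomorphicAE ι hcpt ρ`, definitionally the crux's
conclusion).

This file concludes the crux BY NAME from four named stubs, cut along the route's own intended proof
("Hida control makes the limit eigensystem classical of regular weight; a classical eigenform with Galois
trace `T` is not cuspidal (purity / `NoProperAutomorphicConstituent`), hence boundary = induced from a
cuspidal `π` on the Siegel Levi; HLTT for `π`"), with ONE extra cut forced by the typing of the crux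
(`∀ μ`, see `stub_classicalWeight`):

* `stub_classicalWeight` — **WLOG the weight of `R₀ = ρ ⊕ (ρ∘θ)^∨ ⊗ μ` is classical.**  If `T_{ρ,μ}`
  is such a limit for SOME `μ`, it is one for some `μ'` which is a.e. unramified and cyclotomic-ordinary
  with an INTEGER exponent at every `v ∣ ℓ` (`FramedGaloisRep.IsCyclotomicOrdinaryAt` in rank one), at
  level `S_{ρ,μ'}`.  Trivial (`μ' := μ`) in the route's intended scope (C1 is meant to deliver an
  algebraic `μ` with `μ^c = μ`); NOT trivial as typed: the crux quantifies over every `μ`, and limits of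
  limits being limits (`IsOrdinaryPolarizedAutomorphicLimit.of_approx`), the Harris–Lan–Taylor–Thorne
  congruences along `ℓ`-adically convergent twists `ε^{-2N_i}` produce limit data at NON-classical `μ`
  (where no classicality theorem can start).  This stub carries exactly that over-generality; a tenure
  restatement of C2 with a classical `μ` makes it `rfl`-trivial.
* `stub_exactAtClassicalWeight` — **CLASSICALITY: an ordinary Siegel-shaped limit at classical weight is
  EXACT.**  For `μ` of classical weight, the limit datum can be taken with `M = ∞`: there are finitely
  many cuspidal regular algebraic `Π_j` on `GL_{d_j}(𝔸_K)`, `∑ d_j = 2n`, with Galois representations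
  `r_j` attached in the sense of lang.S27 at every `v ∤ ℓ` (`IsGaloisCompatibleAt`), such that
  `∑_j tr r_j = T_{ρ,μ}` ON THE NOSE.  This is the route's "Hida control on `U(n,n)` INCLUDING the
  boundary makes the limit eigensystem classical of regular weight" (Hida2002; SkinnerUrban2014 for
  `U(2,2)`; Harris1984: the classical form is a Siegel–Eisenstein series / its cuspidal support is an
  isobaric datum) stated at `GL`-level (no unitary group in the tree).  THE HARDEST STUB: Eisenstein
  (boundary) classicality on `U(n,n)` is not in print beyond `U(2,2)`; irregular classical weights are
  inside its burden; and — an observation of this seat for the lead (birth.md § Honest note) — at a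
  classical (very) regular weight, CUSPIDAL-stable ordinary points are expected to be `ℓ`-adically
  ISOLATED from the Siegel–Eisenstein point (exact vertical control for ordinary cusp forms + Mok: the
  Siegel parameter is not elliptic), so the hypothesis is met by Eisenstein-shape data and the content is
  block separation + classicality on the Levi.
* `stub_leviReciprocity` — **RECIPROCITY ON THE LEVI from an exact datum (algebra).**  If
  `T_{ρ,μ} = ∑_j tr r_j` exactly, `ρ` irreducible, and `ρ` is not a proper constituent of any `r(Q)`,
  `Q` cuspidal regular algebraic on `GL_d`, `d > n` (the clause of `NoProperAutomorphicConstituent`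
  for this `ρ`), then `ρ` is automorphic: Brauer–Nesbitt in characteristic `0`
  (`Literature.RepresentationTheory.Semisimple`: `(⊕ r_j)^{ss} ≅ ρ ⊕ ((ρ∘θ)^∨ ⊗ μ)^{ss}`), so `ρ` is a
  Jordan–Hölder constituent of some `r_j`; `d_j > n` is excluded by the clause, hence `d_j = n`,
  `r_j ≅ ρ`, and `Π_j ⊗ |det|^{(1-n)/2}` is the L-algebraic cuspidal partner
  (`exists_twist_isRegular_isLAlgebraic`, `hasSatakeParamAt_map_cpow_of_twist`, `IsAutomorphicAE.of_equiv`).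
  Size M/L, provable with tree tools.
* `stub_noProperConstituent` — verbatim the route item `NoProperAutomorphicConstituent`
  (stmt-Langlands-2694, auto-crux, conjecture-grade: irreducibility of automorphic Galois
  representations, BLGGT 2014 §5 / Patrikis–Taylor), read back by `noProperConstituent_iff`; it closes
  by `exact` when 2694 lands and is listed so that every input of the composition is a named stub.

`SiegelLimitReciprocity_of` — the composition, kernel-checked, no `sorry`: unfold the crux's inline limit
clause to the named one (`isOrdinaryPolarizedAutomorphicLimit_iff`; the level set is curried), move to a
classical `μ'` (stub 1), make the datum exact (stub 2), and read reciprocity for `ρ` off the Levi (stub 3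
fed by stub 4).  Concludes the route decl BY NAME; its conclusion `IsAutomorphicAE ι hcpt ρ` is the crux's
`∃ π, π.1.IsLAlgebraic ∧ ∀ᶠ v, …` definitionally (`isAutomorphicAE_iff` is `Iff.rfl`).

Disproof used: none on file for this crux (`ledger crux ls stmt-Langlands-2691`: no workfiles, no
`Disproof.lean`, no `Negative/` lemmas, 2026-08-17); negatives index: no SiegelEisensteinFern entry.

Shape (for `ledger skeleton check`): stubs `theorem stub_<name> : <signature> := by sorry` stated over tree
declarations only (`IsOrdinaryPolarizedAutomorphicLimit`, `siegelEisensteinTrace`, `IsTracePolarized`,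
`FramedGaloisRep.IsCyclotomicOrdinaryAt`, `IsGaloisCompatibleAt`, `IsAutomorphicAE`,
`NumberField.HasSplitImaginaryQuadraticSubfield`, `absGaloisRestrict`, `CuspidalAutomorphicRepData`,
`IsRegularAlgebraic`, `HasSatakeParamAt`, `arithFrobPolyOfSatake`, `FramedRep.trace/dual`, Mathlib);
`_Goal.stub_<name> : Prop := type_of% @stub_<name>` names each statement; the composition
`SiegelLimitReciprocity_of (h₁ … h₄ : _Goal.stub_…) : SiegelLimitReciprocity` is proved without `sorry`.
-/

set_option linter.dupNamespace false
set_option linter.unusedVariables false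

noncomputable section

namespace Summit.Langlands.Langlands.Cruxes.SiegelLimitReciprocity.Birth

open scoped BigOperators NumberField
open NumberField IsDedekindDomain Field Filter
open Literature.NumberTheory.Automorphic Literature.NumberTheory.GaloisRepresentations
open Summit.Langlands.Langlands.Theses.SiegelEisensteinFern

/-! ## 1. The four stubs -/

/-- **STUB 1 — WLOG classical weight.**  Under BIND: if for some character `μ` the Siegel–Eisenstein
trace `T_{ρ,μ}` is an ordinary polarized cuspidal-automorphic limit of total dimension `2n` and level
`S_{ρ,μ}`, then the same holds for some `μ'` which is unramified almost everywhere and cyclotomic-ordinary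
(unramified · `ε_ℓ^{w_v}`, `w_v ∈ ℤ`) at every `v ∣ ℓ`, at level `S_{ρ,μ'}`.  Trivial with `μ' := μ` when
`μ` already has classical weight (the intended scope of the route: C1's `μ` is meant algebraic with
`μ^c = μ`); the content is the over-general `∀ μ` of the crux as typed — limit data also sit at
NON-classical characters on the `μ`-line over an automorphic `ρ` (limits of limits,
`IsOrdinaryPolarizedAutomorphicLimit.of_approx`, applied to HLTT's congruences along `ℓ`-adically
convergent twists `ε^{-2N_i}`, HarrisLanTaylorThorneRMS2016 §6), and from such a point no classicality
theorem starts; moving along the ordinary family to a classical member of the `μ`-line is what this stub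
asks.  Expected true (implied, with the exact datum of an automorphic `ρ`, by the summit); size: S in
scope, XL out of scope.  Recommend (tenure): restate C2 with `μ` of classical weight — then this stub is
`⟨μ, ‹_›, ‹_›, ‹_›⟩`.
[cite: HarrisLanTaylorThorneRMS2016, §6.1, Cor. 6.26–6.27] [cite: Hida2002, control theorems] -/
theorem stub_classicalWeight :
    ∀ (K : Type) [Field K] [NumberField K] [IsCMField K] (n : ℕ), 2 ≤ n →
    ∀ (ℓ : ℕ) [Fact ℓ.Prime] (ι : PadicAlgCl ℓ ≃+* ℂ),
    NumberField.HasSplitImaginaryQuadraticSubfield K ℓ →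
    ∀ (c : absoluteGaloisGroup (maximalRealSubfield K))
      (θ : absoluteGaloisGroup K →ₜ* absoluteGaloisGroup K),
    c ∉ Set.range (absGaloisRestrict (maximalRealSubfield K) K) →
    (∀ σ, absGaloisRestrict (maximalRealSubfield K) K (θ σ) =
      c * absGaloisRestrict (maximalRealSubfield K) K σ * c⁻¹) →
    ∀ (ρ : FramedGaloisRep K (PadicAlgCl ℓ) n), ρ.toGaloisRep.IsIrreducible →
    ¬ IsTracePolarized θ ρ.trace →
    (∀ᶠ v : HeightOneSpectrum (𝓞 K) in cofinite, ρ.IsUnramifiedAt v) →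
    (∀ v : HeightOneSpectrum (𝓞 K), ((ℓ : ℕ) : 𝓞 K) ∈ v.asIdeal → ρ.IsCyclotomicOrdinaryAt v) →
    ∀ (μ : FramedGaloisRep K (PadicAlgCl ℓ) 1),
    IsOrdinaryPolarizedAutomorphicLimit ι θ (n + n)
      {v | ρ.IsUnramifiedAt v ∧ μ.IsUnramifiedAt v ∧ ((ℓ : ℕ) : 𝓞 K) ∉ v.asIdeal}
      (siegelEisensteinTrace θ ρ μ) →
    ∃ μ' : FramedGaloisRep K (PadicAlgCl ℓ) 1,
      (∀ᶠ v : HeightOneSpectrum (𝓞 K) in cofinite, μ'.IsUnramifiedAt v) ∧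
      (∀ v : HeightOneSpectrum (𝓞 K), ((ℓ : ℕ) : 𝓞 K) ∈ v.asIdeal → μ'.IsCyclotomicOrdinaryAt v) ∧
      IsOrdinaryPolarizedAutomorphicLimit ι θ (n + n)
        {v | ρ.IsUnramifiedAt v ∧ μ'.IsUnramifiedAt v ∧ ((ℓ : ℕ) : 𝓞 K) ∉ v.asIdeal}
        (siegelEisensteinTrace θ ρ μ') := by
  sorry

/-- **STUB 2 — CLASSICALITY: an ordinary Siegel-shaped limit at classical weight is EXACT (the hardest
stub).**  Under BIND, for `μ` a.e. unramified and cyclotomic-ordinary with integer exponent at every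
`v ∣ ℓ`: if `T_{ρ,μ} = tr ρ + tr μ · tr ((ρ∘θ)^∨)` is an ordinary polarized cuspidal-automorphic limit of
dimension `2n` and level `S_{ρ,μ}`, then it is EXACTLY the total trace of Galois representations `r_j`
attached (lang.S27 compatibility at every `v ∤ ℓ`, `IsGaloisCompatibleAt`) to finitely many cuspidal
regular algebraic `Π_j` on `GL_{d_j}(𝔸_K)`, `∑ d_j = 2n`.  Intended proof (route header): the limit
eigensystem lies in Hida's ordinary Hecke algebra of the quasi-split `U(n,n)` at tame level bounded by
that of `R₀` (conductors are bounded along the limit: the wild part is residually rigid), its weight is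
the classical weight of `R₀ = ρ ⊕ (ρ∘θ)^∨ ⊗ μ`; Hida's vertical control theorem for coherent `H⁰` on the
`U(n,n)` Shimura variety INCLUDING the boundary (Hida2002; SkinnerUrban2014 §6 for `U(2,2)`) makes it
the eigensystem of a classical ordinary form, whose cuspidal support (Harris1984: boundary forms are
Eisenstein series induced from cuspidal data on Levi subgroups; Mok2014 / Labesse base change for the
cuspidal part) is an isobaric datum `⊞ Π_j` with `∑ tr r(Π_j) = T_{ρ,μ}`.  Why it might fail / what it
costs: boundary classicality on `U(n,n)` for `n ≥ 3` is not in print; "sufficiently regular" conditions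
may exclude the weight of `R₀` (irregular classical weights are inside this stub); and at a classical very
regular weight cuspidal-stable ordinary points should be `ℓ`-adically isolated from the Siegel–Eisenstein
point (exact control for ordinary CUSP forms + the Siegel parameter is not elliptic, Mok2014 Thm 2.5.2),
so the hypothesis is realised by Eisenstein-shape (Levi-type) data, for which the content is block
separation (Bellaïche–Chenevier) + classicality of ordinary `ℓ`-adic eigensystems of regular weight on
the Levi `Res_{K/K⁺} GL_n` (Hida 1995/1998 control for `GL_n`; Khare–Thorne 2017).  Expected true
(implied by the summit: `ρ` and `(ρ∘θ_c)^∨ ⊗ μ` are then attached to cuspidal regular algebraic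
representations of `GL_n(𝔸_K)`, `μ` being geometric).  Size XL.
[cite: Hida2002, Thm. (control of coherent cohomology, PEL type)] [cite: SkinnerUrban2014, §6]
[cite: Harris1984, boundary cohomology / Eisenstein series] [cite: Mok2014, Thm. 2.5.2] -/
theorem stub_exactAtClassicalWeight :
    ∀ (K : Type) [Field K] [NumberField K] [IsCMField K] (n : ℕ), 2 ≤ n →
    ∀ (ℓ : ℕ) [Fact ℓ.Prime] (ι : PadicAlgCl ℓ ≃+* ℂ),
    NumberField.HasSplitImaginaryQuadraticSubfield K ℓ →
    ∀ (c : absoluteGaloisGroup (maximalRealSubfield K))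
      (θ : absoluteGaloisGroup K →ₜ* absoluteGaloisGroup K),
    c ∉ Set.range (absGaloisRestrict (maximalRealSubfield K) K) →
    (∀ σ, absGaloisRestrict (maximalRealSubfield K) K (θ σ) =
      c * absGaloisRestrict (maximalRealSubfield K) K σ * c⁻¹) →
    ∀ (ρ : FramedGaloisRep K (PadicAlgCl ℓ) n), ρ.toGaloisRep.IsIrreducible →
    ¬ IsTracePolarized θ ρ.trace →
    (∀ᶠ v : HeightOneSpectrum (𝓞 K) in cofinite, ρ.IsUnramifiedAt v) →
    (∀ v : HeightOneSpectrum (𝓞 K), ((ℓ : ℕ) : 𝓞 K) ∈ v.asIdeal → ρ.IsCyclotomicOrdinaryAt v) →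
    ∀ (μ : FramedGaloisRep K (PadicAlgCl ℓ) 1),
    (∀ᶠ v : HeightOneSpectrum (𝓞 K) in cofinite, μ.IsUnramifiedAt v) →
    (∀ v : HeightOneSpectrum (𝓞 K), ((ℓ : ℕ) : 𝓞 K) ∈ v.asIdeal → μ.IsCyclotomicOrdinaryAt v) →
    IsOrdinaryPolarizedAutomorphicLimit ι θ (n + n)
      {v | ρ.IsUnramifiedAt v ∧ μ.IsUnramifiedAt v ∧ ((ℓ : ℕ) : 𝓞 K) ∉ v.asIdeal}
      (siegelEisensteinTrace θ ρ μ) →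
    ∃ (k : ℕ) (d : Fin k → ℕ) (hd : ∀ j, isCompact_glFiniteIntegralLevel (d j) K)
      (P : ∀ j, CuspidalAutomorphicRepData (d j) K (hd j))
      (r : ∀ j, FramedGaloisRep K (PadicAlgCl ℓ) (d j)),
      (∑ j, d j = n + n) ∧
      (∀ j, (P j).1.IsRegularAlgebraic ∧
        ∀ v : HeightOneSpectrum (𝓞 K), ((ℓ : ℕ) : 𝓞 K) ∉ v.asIdeal →
          IsGaloisCompatibleAt (P j).1 ι (r j) v) ∧
      ∀ σ, ∑ j, (r j).trace σ = siegelEisensteinTrace θ ρ μ σ := by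
  sorry

/-- **STUB 3 — RECIPROCITY ON THE LEVI from an exact datum (representation theory + the C/L twist).**
Let `ρ : Γ_K → GL_n(ℚ̄_ℓ)` be irreducible (`K` any number field, `n ≥ 2`, any `θ`, any `μ`).  Assume the
clause of `NoProperAutomorphicConstituent` for this `ρ` (`ρ` is never a proper constituent, in trace
form `tr r = tr ρ + tr ρ₂`, of an `r` attached at every `v ∤ ℓ` to a cuspidal regular algebraic `Q` on
`GL_d(𝔸_K)`, `d > n`), and an EXACT datum: cuspidal regular algebraic `Π_j` on `GL_{d_j}(𝔸_K)`,
`∑ d_j = 2n`, with `r_j` attached at every `v ∤ ℓ` and `∑_j tr r_j = T_{ρ,μ}`.  Then `ρ` is automorphic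
(`IsAutomorphicAE ι hcpt ρ`: an L-algebraic cuspidal `π` on `GL_n(𝔸_K)` with a.e. Satake–Frobenius
matching, `m = 1`).  Proof plan: `T_{ρ,μ}` is the character of `ρ ⊕ ρ₂`, `ρ₂ = (ρ∘θ)^∨ ⊗ μ`
(`siegelEisensteinTrace_apply`); by Brauer–Nesbitt in characteristic `0`
(`Literature.RepresentationTheory.Semisimple.EquivOfCharacter` /`BrauerNesbitt`:
`Representation.nonempty_equiv_of_character_eq_of_isSemisimple`, with `exists_semisimplification`) the
semisimplifications of `⊕_j r_j` and `ρ ⊕ ρ₂` agree, so the irreducible `ρ` is a Jordan–Hölder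
constituent of some `r_j`; if `d_j > n`, framing the complement of `ρ` in `r_j^{ss}` gives `ρ₂'` with
`tr r_j = tr ρ + tr ρ₂'`, excluded by the clause; so `d_j = n` and `r_j ≅ ρ` (a representation with
irreducible semisimplification is irreducible; equal characters ⇒ conjugate frames,
`FramedRep.exists_eq_conj_of_equiv`); finally `Π_j` is cuspidal regular algebraic with `r_j` attached in
the C-normalisation (`arithFrobPolyOfSatake ι q_v n α`), and its twist `Π_j ⊗ |det|^{(1-n)/2}` is
L-algebraic with Satake parameters `q_v^{(n-1)/2} α` (`exists_twist_isRegular_isLAlgebraic`,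
`hasSatakeParamAt_map_cpow_of_twist`), i.e. matches `ρ` with `m = 1` a.e. (`hasSatakeParamAt_cofinite`
for the a.e. clause, `IsAutomorphicAE.of_equiv`).  TRUE in substance (pure algebra + bookkeeping); size
M/L (general-rank continuous semisimplification and the complement frame are the Lean work).
[cite: BourbakiAlgebreVIII2012, VIII §20 n°6 Thm. 2, Cor. 1] [cite: BuzzardGeeLMS2014, §2.1, Conj. 3.2.1]
[cite: HarrisLanTaylorThorneRMS2016, Thm. A (normalisation)] -/
theorem stub_leviReciprocity :
    ∀ (K : Type) [Field K] [NumberField K] (n : ℕ) (hcpt : isCompact_glFiniteIntegralLevel n K), 2 ≤ n →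
    ∀ (ℓ : ℕ) [Fact ℓ.Prime] (ι : PadicAlgCl ℓ ≃+* ℂ)
      (θ : absoluteGaloisGroup K →ₜ* absoluteGaloisGroup K)
      (ρ : FramedGaloisRep K (PadicAlgCl ℓ) n), ρ.toGaloisRep.IsIrreducible →
    ∀ (μ : FramedGaloisRep K (PadicAlgCl ℓ) 1),
    (∀ (d : ℕ) (hd : isCompact_glFiniteIntegralLevel d K) (Q : CuspidalAutomorphicRepData d K hd)
        (r : FramedGaloisRep K (PadicAlgCl ℓ) d), n < d → Q.1.IsRegularAlgebraic →
        (∀ v (α : Multiset ℂ), (Q).1.HasSatakeParamAt v α → ((ℓ : ℕ) : 𝓞 K) ∉ v.asIdeal →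
          (r).IsUnramifiedAt v ∧
            (r).HasFrobCharpolyAt v (arithFrobPolyOfSatake ι v.residueCard (d) α)) →
        ¬ ∃ ρ₂ : FramedGaloisRep K (PadicAlgCl ℓ) (d - n), ∀ σ, r.trace σ = ρ.trace σ + ρ₂.trace σ) →
    (∃ (k : ℕ) (d : Fin k → ℕ) (hd : ∀ j, isCompact_glFiniteIntegralLevel (d j) K)
        (P : ∀ j, CuspidalAutomorphicRepData (d j) K (hd j))
        (r : ∀ j, FramedGaloisRep K (PadicAlgCl ℓ) (d j)),
        (∑ j, d j = n + n) ∧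
        (∀ j, (P j).1.IsRegularAlgebraic ∧
          ∀ v : HeightOneSpectrum (𝓞 K), ((ℓ : ℕ) : 𝓞 K) ∉ v.asIdeal →
            IsGaloisCompatibleAt (P j).1 ι (r j) v) ∧
        ∀ σ, ∑ j, (r j).trace σ = siegelEisensteinTrace θ ρ μ σ) →
    IsAutomorphicAE ι hcpt ρ := by
  sorry

/-- **STUB 4 — no proper automorphic constituent (verbatim the route item `NoProperAutomorphicConstituent`,
stmt-Langlands-2694; read-back `noProperConstituent_iff`).**  Under BIND, for every `μ`, every `d > n`,
every cuspidal regular algebraic `Q` on `GL_d(𝔸_K)` with `r` attached at every `v ∤ ℓ`: `ρ` is not a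
constituent of `r` in trace form (`¬ ∃ ρ₂, tr r = tr ρ + tr ρ₂`).  A special case of the irreducibility
conjecture for automorphic Galois representations (known for `d ≤ 6` in many regular cases and for a
density-one set of `ℓ` in the polarized case; open for fixed `ℓ` in general); conjecture-grade, filed by
the route as the irreducibility input of C2 and used here exactly there (it feeds stub 3).  Closes by
`exact` when stmt-Langlands-2694 lands.
[cite: BarnetlambEtAl2014, §5 (Thm. 5.5.2-type irreducibility)] [cite: Calegari2023, §10] -/
theorem stub_noProperConstituent :
    ∀ (K : Type) [Field K] [NumberField K] [NumberField.IsCMField K] (n : ℕ)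
      (hcpt : isCompact_glFiniteIntegralLevel n K), 2 ≤ n →
    ∀ (ℓ : ℕ) [Fact ℓ.Prime] (ι : PadicAlgCl ℓ ≃+* ℂ),
    (∃ F₀ : IntermediateField ℚ K, (Module.finrank ℚ F₀ = 2 ∧ NumberField.IsTotallyComplex F₀) ∧
      ∃ w w' : HeightOneSpectrum (𝓞 F₀), w ≠ w' ∧
        (ℓ : 𝓞 F₀) ∈ w.asIdeal ∧ (ℓ : 𝓞 F₀) ∈ w'.asIdeal) →
    ∀ (c : absoluteGaloisGroup (maximalRealSubfield K))
      (θ : absoluteGaloisGroup K →ₜ* absoluteGaloisGroup K),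
    c ∉ Set.range (absGaloisRestrict (maximalRealSubfield K) K) →
    (∀ σ, absGaloisRestrict (maximalRealSubfield K) K (θ σ) =
      c * absGaloisRestrict (maximalRealSubfield K) K σ * c⁻¹) →
    ∀ (ρ : FramedGaloisRep K (PadicAlgCl ℓ) n), ρ.toGaloisRep.IsIrreducible →
    (¬ ∃ χ : FramedGaloisRep K (PadicAlgCl ℓ) 1, ∀ σ, ρ.trace (θ σ) = χ.trace σ * ρ.trace σ⁻¹) →
    (∀ᶠ v in Filter.cofinite, ρ.IsUnramifiedAt v) →
    (∀ v : HeightOneSpectrum (𝓞 K), (ℓ : 𝓞 K) ∈ v.asIdeal →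
      ∃ (g : Matrix.GeneralLinearGroup (Fin n) (PadicAlgCl ℓ)) (b : Fin n → ℤ)
        (ψ : Fin n → FramedRep (absoluteGaloisGroup (v.adicCompletion K)) (PadicAlgCl ℓ) 1),
        StrictAnti b ∧ (∀ i, (ψ i).IsLocallyUnramified) ∧
          ∀ σ, (∀ i₁ i₂ : Fin n, i₂ < i₁ → (((ρ).toLocal v).conj g σ).val i₁ i₂ = 0) ∧
            (∀ i, (((ρ).toLocal v).conj g σ).val i i = (ψ i).trace σ *
              (algebraMap ℚ_[ℓ] (PadicAlgCl ℓ)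
                ((GaloisRep.cyclotomicCharacter (v.adicCompletion K) ℓ σ : ℤ_[ℓ]ˣ) : ℤ_[ℓ])) ^ (b i))) →
    ∀ (μ : FramedGaloisRep K (PadicAlgCl ℓ) 1) (d : ℕ) (hd : isCompact_glFiniteIntegralLevel d K)
      (Q : CuspidalAutomorphicRepData d K hd) (r : FramedGaloisRep K (PadicAlgCl ℓ) d),
    n < d → Q.1.IsRegularAlgebraic →
    (∀ v (α : Multiset ℂ), (Q).1.HasSatakeParamAt v α → (ℓ : 𝓞 K) ∉ v.asIdeal →
      (r).IsUnramifiedAt v ∧ (r).HasFrobCharpolyAt v (arithFrobPolyOfSatake ι v.residueCard (d) α)) →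
    ¬ ∃ ρ₂ : FramedGaloisRep K (PadicAlgCl ℓ) (d - n), ∀ σ, r.trace σ = ρ.trace σ + ρ₂.trace σ := by
  sorry

/-! ## 2. The stub statements as named `Prop`s (literally their types) and read-backs -/

namespace _Goal

/-- The statement of `stub_classicalWeight`, as a named `Prop` (literally its type). [folklore] -/
def stub_classicalWeight : Prop :=
  type_of% @Summit.Langlands.Langlands.Cruxes.SiegelLimitReciprocity.Birth.stub_classicalWeight

/-- The statement of `stub_exactAtClassicalWeight`, as a named `Prop` (literally its type). [folklore] -/
def stub_exactAtClassicalWeight : Prop :=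
  type_of% @Summit.Langlands.Langlands.Cruxes.SiegelLimitReciprocity.Birth.stub_exactAtClassicalWeight

/-- The statement of `stub_leviReciprocity`, as a named `Prop` (literally its type). [folklore] -/
def stub_leviReciprocity : Prop :=
  type_of% @Summit.Langlands.Langlands.Cruxes.SiegelLimitReciprocity.Birth.stub_leviReciprocity

/-- The statement of `stub_noProperConstituent`, as a named `Prop` (literally its type). [folklore] -/
def stub_noProperConstituent : Prop :=
  type_of% @Summit.Langlands.Langlands.Cruxes.SiegelLimitReciprocity.Birth.stub_noProperConstituent

end _Goal

/-- Read-back: stub 4 IS the route item `NoProperAutomorphicConstituent` (definitionally). [folklore] -/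
theorem noProperConstituent_iff : _Goal.stub_noProperConstituent ↔ NoProperAutomorphicConstituent :=
  Iff.rfl

/-- Read-back: the crux's conclusion is the named automorphy predicate (definitionally), and its split
clause is `NumberField.HasSplitImaginaryQuadraticSubfield` (definitionally). [folklore] -/
theorem vocabulary_rfl {K : Type} [Field K] [NumberField K] {n : ℕ}
    (hcpt : isCompact_glFiniteIntegralLevel n K) {ℓ : ℕ} [Fact ℓ.Prime] (ι : PadicAlgCl ℓ ≃+* ℂ)
    (ρ : FramedGaloisRep K (PadicAlgCl ℓ) n) :
    (IsAutomorphicAE ι hcpt ρ ↔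
      ∃ π : CuspidalAutomorphicRepData n K hcpt, π.1.IsLAlgebraic ∧
        ∀ᶠ v : HeightOneSpectrum (𝓞 K) in Filter.cofinite, ∃ α : Multiset ℂ,
          π.1.HasSatakeParamAt v α ∧ ρ.IsUnramifiedAt v ∧
            ρ.HasFrobCharpolyAt v (arithFrobPolyOfSatake ι v.residueCard 1 α)) ∧
    (NumberField.HasSplitImaginaryQuadraticSubfield K ℓ ↔
      ∃ F₀ : IntermediateField ℚ K, (Module.finrank ℚ F₀ = 2 ∧ NumberField.IsTotallyComplex F₀) ∧
        ∃ w w' : HeightOneSpectrum (𝓞 F₀), w ≠ w' ∧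
          (ℓ : 𝓞 F₀) ∈ w.asIdeal ∧ (ℓ : 𝓞 F₀) ∈ w'.asIdeal) :=
  ⟨Iff.rfl, Iff.rfl⟩

/-- The stubs prove their named statements (read-back). -/
theorem goals_hold : _Goal.stub_classicalWeight ∧ _Goal.stub_exactAtClassicalWeight ∧
    _Goal.stub_leviReciprocity ∧ _Goal.stub_noProperConstituent :=
  ⟨stub_classicalWeight, stub_exactAtClassicalWeight, stub_leviReciprocity, stub_noProperConstituent⟩

/-! ## 3. The composition (kernel-checked, no `sorry`): WLOG classical → EXACT → LEVI, the crux by name -/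

/-- **`SiegelLimitReciprocity` from the four stubs.**  Fix BIND, `μ` and the crux's inline limit clause;
rewrite the latter as `IsOrdinaryPolarizedAutomorphicLimit ι θ (n+n) S_{ρ,μ} (siegelEisensteinTrace θ ρ μ)`
(`isOrdinaryPolarizedAutomorphicLimit_iff`; only the level clause needs currying — everything else is
definitional); stub 1 moves to a classical `μ'`; stub 2 makes the datum exact; stub 3, fed with stub 4
(the no-proper-constituent clause for this `ρ`), gives `IsAutomorphicAE ι hcpt ρ`, which is the crux's
conclusion definitionally.  The hypotheses are, by name, the statements of the four stubs; the conclusion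
is the route decl `Summit.Langlands.Langlands.Theses.SiegelEisensteinFern.SiegelLimitReciprocity`. [folklore] -/
theorem SiegelLimitReciprocity_of (h₁ : _Goal.stub_classicalWeight) (h₂ : _Goal.stub_exactAtClassicalWeight)
    (h₃ : _Goal.stub_leviReciprocity) (h₄ : _Goal.stub_noProperConstituent) :
    Summit.Langlands.Langlands.Theses.SiegelEisensteinFern.SiegelLimitReciprocity := by
  -- the stub statements, as the Π-types they literally are
  have H₁ : type_of% @stub_classicalWeight := h₁
  have H₂ : type_of% @stub_exactAtClassicalWeight := h₂
  have H₃ : type_of% @stub_leviReciprocity := h₃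
  have H₄ : type_of% @stub_noProperConstituent := h₄
  intro K _ _ _ n hcpt hn ℓ _ ι hF c θ hc hθ ρ hirr hnp hunr hord μ hlim
  -- the crux's inline limit clause, in the named vocabulary
  have hlim' : IsOrdinaryPolarizedAutomorphicLimit ι θ (n + n)
      {v | ρ.IsUnramifiedAt v ∧ μ.IsUnramifiedAt v ∧ ((ℓ : ℕ) : 𝓞 K) ∉ v.asIdeal}
      (siegelEisensteinTrace θ ρ μ) := by
    rw [isOrdinaryPolarizedAutomorphicLimit_iff]
    intro M
    obtain ⟨k, d, hd, P, r, hN, hj, hpol, happ⟩ := hlim M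
    exact ⟨k, d, hd, P, r, hN, fun j ↦ ⟨(hj j).1, (hj j).2.1,
      fun v hv ↦ (hj j).2.2.1 v hv.1 hv.2.1 hv.2.2, (hj j).2.2.2⟩, hpol, happ⟩
  -- WLOG the weight is classical …
  obtain ⟨μ', hμ'unr, hμ'ord, hlim''⟩ := H₁ K n hn ℓ ι hF c θ hc hθ ρ hirr hnp hunr hord μ hlim'
  -- … there the limit is an exact automorphic datum …
  have hexact := H₂ K n hn ℓ ι hF c θ hc hθ ρ hirr hnp hunr hord μ' hμ'unr hμ'ord hlim''
  -- … off which reciprocity for `ρ` is read on the Levi (no proper constituent: stub 4).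
  exact H₃ K n hcpt hn ℓ ι θ ρ hirr μ' (H₄ K n hcpt hn ℓ ι hF c θ hc hθ ρ hirr hnp hunr hord μ') hexact

/-- By-name sanity check (an `example`, not a declaration of the file): the four stubs feed the
composition as they stand. -/
example : Summit.Langlands.Langlands.Theses.SiegelEisensteinFern.SiegelLimitReciprocity :=
  SiegelLimitReciprocity_of stub_classicalWeight stub_exactAtClassicalWeight stub_leviReciprocity
    stub_noProperConstituent

end Summit.Langlands.Langlands.Cruxes.SiegelLimitReciprocity.Birth

end
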